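import Mathlib.GroupTheory.FreeGroup.Basic
import Mathlib.RepresentationTheory.Basic
import Mathlib.LinearAlgebra.Matrix.SpecialLinearGroup
import Mathlib.Data.Fin.VecNotation
import Literature.AlgebraicGeometry.HodgeTheory.LocallyTrivialExtensionClasses

/-!
# Route LinearSystemTorelli — crux `LocalTubeSpan`: the thin configuration — the representation

Helper file (`--supports stmt-HodgeConjecture-2490`, line `Sketch`, stub `stub_thinRep`).
The line `Sketch` records a NEGATIVE boundary of the crux's mechanism ("cyclic detection":
injectivity of Schnell's third map `H¹(G, V) → ∏_g V/(g - 1)V`): it FAILS for some integral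
symplectic transvection configurations, so the vanishing-lattice (Janssen-completeness)
hypothesis of C. Schnell, *Primitive cohomology and the tube mapping*, Math. Z. 268 (2010)
(= arXiv:0711.3927) §7 Prop. 12 is not idle.  The thin counterexample lives on `V = ℚ²` with the
alternating form `B₀(x, y) = 4 (x₀ y₁ - x₁ y₀)` and the three cycles
`δ₁ = (1, 0)`, `δ₂ = (0, 1)`, `δ₃ = δ₁ + δ₂ = (1, 1)`; the Picard–Lefschetz transvections
`T_i(v) = v - B₀(v, δ_i) δ_i` are

  `T₁(v) = (v₀ + 4 v₁, v₁)`, `T₂(v) = (v₀, v₁ - 4 v₀)`, `T₃(v) = v - 4 (v₀ - v₁) (1, 1)`,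

i.e. the determinant-one integer matrices `[[1, 4], [0, 1]]`, `[[1, 0], [-4, 1]]`,
`[[-3, 4], [-4, 5]]`.  This file supplies the DATA of the counterexample:

* `localTubeSpan_exists_thinRep` — the representation `ρ` of the free group on three letters
  `FreeGroup (Fin 3)` on `Fin 2 → ℚ` in which the letters act by `T₁, T₂, T₃` (built as
  `FreeGroup.lift` into `SL(2, ℚ)`, followed by `Matrix.SpecialLinearGroup.toLin'` and the
  restriction `(V ≃ₗ V) →* (V →ₗ V)`), pinned down by the three closed formulas.

The dynamics (ping-pong: the image is free and thin with three cusps), the dichotomy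
"`g - 1` invertible or `g` conjugate to a generator power", and the undetected non-coboundary
(the relation `δ₃ = δ₁ + δ₂`) are the sibling stubs of the line; together they show that the
multi-orbit form of [Schnell2010] §7 Prop. 12 is false without its vanishing-lattice hypothesis.

Reference: C. Schnell, Primitive cohomology and the tube mapping, Math. Z. 268 (2010), §7
Prop. 12.  Elementary; no named facts.
-/

-- `Summit.HodgeConjecture.HodgeConjecture.Theorems` is the mandated namespace (single-conjunct summit:
-- Sub = Summit), which `linter.dupNamespace` flags on every declaration; the lakefile turns the
-- linter off tree-wide (weak option), restated here so stand-alone elaboration is warning-free too.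
set_option linter.dupNamespace false

noncomputable section

namespace Summit.HodgeConjecture.HodgeConjecture.Theorems

/-- **The thin transvection representation.** The free group on three letters acts on `ℚ²`, the
letters `0, 1, 2` acting by the three Picard–Lefschetz transvections
`T₁(v) = (v₀ + 4 v₁, v₁)`, `T₂(v) = (v₀, v₁ - 4 v₀)`, `T₃(v) = v - 4 (v₀ - v₁) (1, 1)` along
`δ₁ = (1, 0)`, `δ₂ = (0, 1)`, `δ₃ = (1, 1)` for the alternating form
`B₀(x, y) = 4 (x₀ y₁ - x₁ y₀)`.  Construction: the three matrices `[[1, 4], [0, 1]]`,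
`[[1, 0], [-4, 1]]`, `[[-3, 4], [-4, 5]]` have determinant one, so `FreeGroup.lift` maps the free
group to `SL(2, ℚ)`, which acts on `Fin 2 → ℚ` through `Matrix.SpecialLinearGroup.toLin'`.
[folklore] -/
theorem localTubeSpan_exists_thinRep : ∃ ρ : Representation ℚ (FreeGroup (Fin 3)) (Fin 2 → ℚ),
    (∀ v, ρ (FreeGroup.of 0) v = ![v 0 + 4 * v 1, v 1]) ∧
    (∀ v, ρ (FreeGroup.of 1) v = ![v 0, v 1 - 4 * v 0]) ∧
    (∀ v, ρ (FreeGroup.of 2) v = ![v 0 - 4 * (v 0 - v 1), v 1 - 4 * (v 0 - v 1)]) := by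
  -- the three transvection matrices, of determinant one
  let T : Fin 3 → Matrix.SpecialLinearGroup (Fin 2) ℚ :=
    ![⟨!![1, 4; 0, 1], by norm_num [Matrix.det_fin_two_of]⟩,
      ⟨!![1, 0; -4, 1], by norm_num [Matrix.det_fin_two_of]⟩,
      ⟨!![-3, 4; -4, 5], by norm_num [Matrix.det_fin_two_of]⟩]
  refine ⟨(LinearEquiv.automorphismGroup.toLinearMapMonoidHom.comp
      Matrix.SpecialLinearGroup.toLin').comp (FreeGroup.lift T),
    fun v => ?_, fun v => ?_, fun v => ?_⟩
  · -- `T₁ = [[1, 4], [0, 1]]`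
    funext i
    fin_cases i
    · simp [T, Matrix.SpecialLinearGroup.toLin'_apply, Matrix.mulVec, dotProduct,
        Fin.sum_univ_two]
    · simp [T, Matrix.SpecialLinearGroup.toLin'_apply, Matrix.mulVec, dotProduct,
        Fin.sum_univ_two]
  · -- `T₂ = [[1, 0], [-4, 1]]`
    funext i
    fin_cases i
    · simp [T, Matrix.SpecialLinearGroup.toLin'_apply, Matrix.mulVec, dotProduct,
        Fin.sum_univ_two]
    · simp [T, Matrix.SpecialLinearGroup.toLin'_apply, Matrix.mulVec, dotProduct,
        Fin.sum_univ_two]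
      ring
  · -- `T₃ = [[-3, 4], [-4, 5]]`
    funext i
    fin_cases i
    · simp [T, Matrix.SpecialLinearGroup.toLin'_apply, Matrix.mulVec, dotProduct,
        Fin.sum_univ_two]
      ring
    · simp [T, Matrix.SpecialLinearGroup.toLin'_apply, Matrix.mulVec, dotProduct,
        Fin.sum_univ_two]
      ring

end Summit.HodgeConjecture.HodgeConjecture.Theorems

end
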